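import Literature.GroupTheory.CombinatorialGroupTheory.FreeProductSurfaceSeparationLevels
import Literature.GroupTheory.CombinatorialGroupTheory.PuncturedSurfaceGroupChainUnrQuotientCoprod
import HarnessLib

/-!
# Separating levels in `Γ_{g₀,0} ∗ (Γ_{g₁,0} ∗ Γ_{g₂,0})`, pulled back to `Γ_{g,r}` — the three-component CHAIN (`Π^unr` side, discrete form)

Topic `Literature/GroupTheory/CombinatorialGroupTheory`; theorems only, elementary.  [CombGC] Def. 1.1 (ii) /
Prop. 1.2 proof p. 9 [cite: MochizukiCombGC2007, Prop 1.2 proof p.9]: at STURDY data the `Π^unr`-verticial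
separating covering is, at the discrete level, a normal subgroup `U' ⊴ N` of a level `N = ι⁻¹(V) ⊴ Γ_{g,r}`
read through the unramified quotient `θ : Γ_{g,r} ↠ Γ_{g,r}/K`.  abc-iut-w5-d047's
`FreeProductSurfaceSeparationLevels.lean` supplies the two abstract separating levels (same factor: the fibred
twist of abc-iut-f-166; cross factor: projection to the alive factor) for `K` with `Γ/K ≅ A ∗ C`, and the
bookkeeping at the TWO-COMPONENT data.  This file (abc-iut-f-164 gen 4) adds what the THREE-COMPONENT CHAIN
of abc-iut-f-164 (`PSCThreeChainShape.lean`; `K = ⟨⟨c_j, ε_A, η⟩⟩`,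
`Γ/K ≅ Γ_{g₀,0} ∗ (Γ_{g₁,0} ∗ Γ_{g₂,0})` by `PuncturedSurfaceGroupChainUnrQuotientCoprod.lean`) needs:

* `exists_normal_separating_crossFactor_of_le` — the cross-factor level when the killed vertex group maps INTO
  (not onto) the second factor (three factors: the second factor is the free product of the two other vertex
  groups);
* `PuncturedSurfaceGroup.exists_coprod_chain_pinned` — the chain Tietze isomorphism in the THREE orientations
  `Γ_{g_v,0} ∗ (⋯) ≃* Γ/K` putting each vertex `v₀`, `v_mid`, `v₁` in the alive (first-factor) role, handle
  letters pinned;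
* `map_mk_closure_chainMid_eq_range`, `map_mk_closure_chainLast_eq_range` — the images in `Γ/K` of the
  generating sets of `Π_{v_mid}`, `Π_{v₁}` are the corresponding factors (for `Π_{v₀}` the two-component lemma
  `map_mk_closure_v0_eq_range` applies verbatim).

Nothing here concerns [IUTchIII].
-/

namespace Literature.GroupTheory.CombinatorialGroupTheory

open Monoid (Coprod)
open scoped Pointwise

/-! ### Cross factor with the killed group inside the second factor -/

section Abstract

variable {Γ A C : Type*} [Group Γ] [Group A] [Group C]

/-- **Cross factor, inclusion form.**  `K ⊴ Γ`, `ē : A ∗ C ≃* Γ/K`, `Hk ≤ Γ` mapping INTO the second factor,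
`N ⊴ Γ`, `ψ : A → M` with `ψ α ≠ 1`, `θ a₀ = ē(inl α)`: the kernel `U' ⊴ N` of `ψ ∘ fst ∘ ē⁻¹ ∘ θ` has index
dividing `|M|`, contains `(f₂ Hk f₂⁻¹ · K) ∩ N` for EVERY `f₂` and not `f₁ a₀ f₁⁻¹` (as
`exists_normal_separating_crossFactor`, whose proof only uses the inclusion). [cite: MochizukiCombGC2007, Prop 1.2 proof p.9] -/
theorem exists_normal_separating_crossFactor_of_le (K : Subgroup Γ) [K.Normal] (ē : Coprod A C ≃* Γ ⧸ K)
    (Hk : Subgroup Γ)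
    (hHk : Hk.map (QuotientGroup.mk' K) ≤ (ē.toMonoidHom.comp (Coprod.inr : C →* Coprod A C)).range)
    (N : Subgroup Γ) [hN : N.Normal] {M : Type*} [CommGroup M] [Finite M] (ψ : A →* M)
    {a₀ : Γ} {α : A} (hα : QuotientGroup.mk' K a₀ = ē (Coprod.inl α)) (hψ : ψ α ≠ 1) (f₁ f₂ : Γ) :
    ∃ U' : Subgroup N, U'.Normal ∧ U'.index ∣ Nat.card M ∧ U'.FiniteIndex ∧
      f₁ * a₀ * f₁⁻¹ ∉ U'.map N.subtype ∧
      ((ConjAct.toConjAct f₂ • Hk) ⊔ K) ⊓ N ≤ U'.map N.subtype := by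
  classical
  set θ := QuotientGroup.mk' K with hθ
  let χ : Γ →* M := ψ.comp (((Coprod.fst : Coprod A C →* A).comp ē.symm.toMonoidHom).comp θ)
  have hχ : ∀ x, χ x = ψ (Coprod.fst (ē.symm (θ x))) := fun x => rfl
  let χN : N →* M := χ.comp N.subtype
  have hidx : χN.ker.index ∣ Nat.card M := by
    rw [Subgroup.index_ker]; exact Subgroup.card_subgroup_dvd_card χN.range
  refine ⟨χN.ker, inferInstance, hidx, ?_, ?_, ?_⟩
  · exact ⟨fun h0 => (Nat.card_pos (α := M)).ne' (Nat.eq_zero_of_zero_dvd (h0 ▸ hidx))⟩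
  · intro hmem
    obtain ⟨n, hn, hn'⟩ := Subgroup.mem_map.mp hmem
    rw [MonoidHom.mem_ker] at hn
    apply hψ
    have h1 : χ (f₁ * a₀ * f₁⁻¹) = ψ α := by
      rw [map_mul, map_mul, map_inv, mul_inv_cancel_comm, hχ, hα, MulEquiv.symm_apply_apply,
        Coprod.fst_apply_inl]
    rw [← h1, ← hn']
    exact hn
  · intro z hz
    refine Subgroup.mem_map.mpr ⟨⟨z, hz.2⟩, ?_, rfl⟩
    rw [MonoidHom.mem_ker]
    change χ z = 1
    have h1 := mk_mem_smul_inf_of_mem K Hk N f₂ hz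
    obtain ⟨y, ⟨hyH, -⟩, hy⟩ := (Subgroup.mem_smul_pointwise_iff_exists _ _ _).mp h1
    obtain ⟨cc, hcc⟩ := hHk hyH
    rw [ConjAct.smul_def, ConjAct.ofConjAct_toConjAct] at hy
    rw [hχ z, hθ, ← hy, ← hcc]
    simp only [map_mul, map_inv, MonoidHom.coe_comp, Function.comp_apply, MulEquiv.coe_toMonoidHom,
      MulEquiv.symm_apply_apply, Coprod.fst_apply_inr, mul_one, mul_inv_cancel, map_one]

end Abstract

namespace PuncturedSurfaceGroup

/-! ### The chain Tietze isomorphism in the three orientations -/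

/-- **The three orientations of `Γ_{g,r}/⟨⟨c_j, ε_A, η⟩⟩ ≅ Γ_{g₀,0} ∗ Γ_{g₁,0} ∗ Γ_{g₂,0}`** (each vertex of the
chain in the alive = first-factor role), handle letters pinned: `ē₀ : Γ_{g₀,0} ∗ (Γ_{g₁,0} ∗ Γ_{g₂,0}) ≃* Γ/K`,
`ē_m : Γ_{g₁,0} ∗ (Γ_{g₀,0} ∗ Γ_{g₂,0}) ≃* Γ/K`, `ē₁ : Γ_{g₂,0} ∗ (Γ_{g₀,0} ∗ Γ_{g₁,0}) ≃* Γ/K` (coproduct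
associators / commutators composed with `exists_mulEquiv_chainUnrQuotient_coprod`).
[cite: MochizukiCombGC2007, Def 1.1(ii) p.7] -/
theorem exists_coprod_chain_pinned (g₀ g₁ g₂ r s₁ s₂ : ℕ) (εA η : PuncturedSurfaceGroup (g₀ + (g₁ + g₂)) r)
    (hεA : εA = ((List.finRange r).map fun j : Fin r =>
        if s₂ ≤ (j : ℕ) then c (g := g₀ + (g₁ + g₂)) j else 1).prod *
      ((List.finRange (g₀ + (g₁ + g₂))).map fun i : Fin (g₀ + (g₁ + g₂)) => if (i : ℕ) < g₀ then
        a (r := r) i * b i * (a i)⁻¹ * (b i)⁻¹ else 1).prod)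
    (hη : η = ((List.finRange r).map fun j : Fin r =>
        if s₁ ≤ (j : ℕ) then c (g := g₀ + (g₁ + g₂)) j else 1).prod *
      ((List.finRange (g₀ + (g₁ + g₂))).map fun i : Fin (g₀ + (g₁ + g₂)) => if (i : ℕ) < g₀ + g₁ then
        a (r := r) i * b i * (a i)⁻¹ * (b i)⁻¹ else 1).prod) :
    ∃ (ē₀ : Coprod (PuncturedSurfaceGroup g₀ 0) (Coprod (PuncturedSurfaceGroup g₁ 0) (PuncturedSurfaceGroup g₂ 0)) ≃*
        PuncturedSurfaceGroup (g₀ + (g₁ + g₂)) r ⧸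
          Subgroup.normalClosure ({εA, η} ∪ Set.range (c : Fin r → PuncturedSurfaceGroup (g₀ + (g₁ + g₂)) r)))
      (ēm : Coprod (PuncturedSurfaceGroup g₁ 0) (Coprod (PuncturedSurfaceGroup g₀ 0) (PuncturedSurfaceGroup g₂ 0)) ≃*
        PuncturedSurfaceGroup (g₀ + (g₁ + g₂)) r ⧸
          Subgroup.normalClosure ({εA, η} ∪ Set.range (c : Fin r → PuncturedSurfaceGroup (g₀ + (g₁ + g₂)) r)))
      (ē₁ : Coprod (PuncturedSurfaceGroup g₂ 0) (Coprod (PuncturedSurfaceGroup g₀ 0) (PuncturedSurfaceGroup g₁ 0)) ≃*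
        PuncturedSurfaceGroup (g₀ + (g₁ + g₂)) r ⧸
          Subgroup.normalClosure ({εA, η} ∪ Set.range (c : Fin r → PuncturedSurfaceGroup (g₀ + (g₁ + g₂)) r))),
      (∀ (i : Fin g₀) (bit : Bool), ē₀ (Coprod.inl (PresentedGroup.of (Sum.inl (i, bit)))) =
        QuotientGroup.mk (PresentedGroup.of (Sum.inl (Fin.castAdd (g₁ + g₂) i, bit)))) ∧
      (∀ (j : Fin g₁) (bit : Bool), ē₀ (Coprod.inr (Coprod.inl (PresentedGroup.of (Sum.inl (j, bit))))) =
        QuotientGroup.mk (PresentedGroup.of (Sum.inl (Fin.natAdd g₀ (Fin.castAdd g₂ j), bit)))) ∧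
      (∀ (k : Fin g₂) (bit : Bool), ē₀ (Coprod.inr (Coprod.inr (PresentedGroup.of (Sum.inl (k, bit))))) =
        QuotientGroup.mk (PresentedGroup.of (Sum.inl (Fin.natAdd g₀ (Fin.natAdd g₁ k), bit)))) ∧
      (∀ (j : Fin g₁) (bit : Bool), ēm (Coprod.inl (PresentedGroup.of (Sum.inl (j, bit)))) =
        QuotientGroup.mk (PresentedGroup.of (Sum.inl (Fin.natAdd g₀ (Fin.castAdd g₂ j), bit)))) ∧
      (∀ (i : Fin g₀) (bit : Bool), ēm (Coprod.inr (Coprod.inl (PresentedGroup.of (Sum.inl (i, bit))))) =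
        QuotientGroup.mk (PresentedGroup.of (Sum.inl (Fin.castAdd (g₁ + g₂) i, bit)))) ∧
      (∀ (k : Fin g₂) (bit : Bool), ēm (Coprod.inr (Coprod.inr (PresentedGroup.of (Sum.inl (k, bit))))) =
        QuotientGroup.mk (PresentedGroup.of (Sum.inl (Fin.natAdd g₀ (Fin.natAdd g₁ k), bit)))) ∧
      (∀ (k : Fin g₂) (bit : Bool), ē₁ (Coprod.inl (PresentedGroup.of (Sum.inl (k, bit)))) =
        QuotientGroup.mk (PresentedGroup.of (Sum.inl (Fin.natAdd g₀ (Fin.natAdd g₁ k), bit)))) ∧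
      (∀ (i : Fin g₀) (bit : Bool), ē₁ (Coprod.inr (Coprod.inl (PresentedGroup.of (Sum.inl (i, bit))))) =
        QuotientGroup.mk (PresentedGroup.of (Sum.inl (Fin.castAdd (g₁ + g₂) i, bit)))) ∧
      (∀ (j : Fin g₁) (bit : Bool), ē₁ (Coprod.inr (Coprod.inr (PresentedGroup.of (Sum.inl (j, bit))))) =
        QuotientGroup.mk (PresentedGroup.of (Sum.inl (Fin.natAdd g₀ (Fin.castAdd g₂ j), bit)))) := by
  obtain ⟨_, e, h0, hm, h1⟩ := exists_mulEquiv_chainUnrQuotient_coprod g₀ g₁ g₂ r s₁ s₂ εA η hεA hη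
  -- the two shuffles
  let σm : Coprod (PuncturedSurfaceGroup g₁ 0) (Coprod (PuncturedSurfaceGroup g₀ 0) (PuncturedSurfaceGroup g₂ 0)) ≃*
      Coprod (PuncturedSurfaceGroup g₀ 0) (Coprod (PuncturedSurfaceGroup g₁ 0) (PuncturedSurfaceGroup g₂ 0)) :=
    ((MulEquiv.coprodAssoc _ _ _).symm.trans
      (MulEquiv.coprodCongr (MulEquiv.coprodComm _ _) (MulEquiv.refl _))).trans (MulEquiv.coprodAssoc _ _ _)
  have hσm₁ : ∀ y : PuncturedSurfaceGroup g₁ 0, σm (Coprod.inl y) = Coprod.inr (Coprod.inl y) := fun y => by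
    simp [σm, MulEquiv.coprodCongr_apply]
  have hσm₂ : ∀ x : PuncturedSurfaceGroup g₀ 0, σm (Coprod.inr (Coprod.inl x)) = Coprod.inl x := fun x => by
    simp [σm, MulEquiv.coprodCongr_apply]
  have hσm₃ : ∀ z : PuncturedSurfaceGroup g₂ 0, σm (Coprod.inr (Coprod.inr z)) = Coprod.inr (Coprod.inr z) :=
    fun z => by simp [σm, MulEquiv.coprodCongr_apply]
  let σ₁ : Coprod (PuncturedSurfaceGroup g₂ 0) (Coprod (PuncturedSurfaceGroup g₀ 0) (PuncturedSurfaceGroup g₁ 0)) ≃*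
      Coprod (PuncturedSurfaceGroup g₀ 0) (Coprod (PuncturedSurfaceGroup g₁ 0) (PuncturedSurfaceGroup g₂ 0)) :=
    (MulEquiv.coprodComm _ _).trans (MulEquiv.coprodAssoc _ _ _)
  have hσ₁₁ : ∀ z : PuncturedSurfaceGroup g₂ 0, σ₁ (Coprod.inl z) = Coprod.inr (Coprod.inr z) := fun z => by
    simp [σ₁]
  have hσ₁₂ : ∀ x : PuncturedSurfaceGroup g₀ 0, σ₁ (Coprod.inr (Coprod.inl x)) = Coprod.inl x := fun x => by
    simp [σ₁]
  have hσ₁₃ : ∀ y : PuncturedSurfaceGroup g₁ 0, σ₁ (Coprod.inr (Coprod.inr y)) = Coprod.inr (Coprod.inl y) :=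
    fun y => by simp [σ₁]
  refine ⟨e.symm, σm.trans e.symm, σ₁.trans e.symm,
    fun i bit => (MulEquiv.symm_apply_eq e).mpr (h0 i bit).symm,
    fun j bit => (MulEquiv.symm_apply_eq e).mpr (hm j bit).symm,
    fun k bit => (MulEquiv.symm_apply_eq e).mpr (h1 k bit).symm,
    fun j bit => ?_, fun i bit => ?_, fun k bit => ?_, fun k bit => ?_, fun i bit => ?_, fun j bit => ?_⟩
  · rw [MulEquiv.trans_apply, hσm₁, MulEquiv.symm_apply_eq, hm]
  · rw [MulEquiv.trans_apply, hσm₂, MulEquiv.symm_apply_eq, h0]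
  · rw [MulEquiv.trans_apply, hσm₃, MulEquiv.symm_apply_eq, h1]
  · rw [MulEquiv.trans_apply, hσ₁₁, MulEquiv.symm_apply_eq, h1]
  · rw [MulEquiv.trans_apply, hσ₁₂, MulEquiv.symm_apply_eq, h0]
  · rw [MulEquiv.trans_apply, hσ₁₃, MulEquiv.symm_apply_eq, hm]

/-! ### The generating sets of `Π_{v_mid}`, `Π_{v₁}` read in `Γ/K` -/

section Vertex

variable {g₀ g₁ g₂ r s₁ s₂ : ℕ} {K : Subgroup (PuncturedSurfaceGroup (g₀ + (g₁ + g₂)) r)} [K.Normal]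

/-- In `Γ/K` (`c_j, ε_A, η ∈ K`) the generating set of `Π_{v_mid}` — handles `g₀ ≤ i < g₀ + g₁`, cusps
`s₁ ≤ j < s₂`, both node loops — generates the middle factor: its image is the range of any hom
`Γ_{g₁,0} → Γ/K` pinned on the middle handle letters. [cite: MochizukiCombGC2007, Def 1.1(ii) p.7] -/
theorem map_mk_closure_chainMid_eq_range (hcK : ∀ j, c j ∈ K) {εA η : PuncturedSurfaceGroup (g₀ + (g₁ + g₂)) r}
    (hεAK : εA ∈ K) (hηK : η ∈ K) (θ : PuncturedSurfaceGroup g₁ 0 →* _ ⧸ K)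
    (hpin : ∀ (j : Fin g₁) (bit : Bool), θ (PresentedGroup.of (Sum.inl (j, bit))) =
      QuotientGroup.mk (PresentedGroup.of (Sum.inl (Fin.natAdd g₀ (Fin.castAdd g₂ j), bit)))) :
    (Subgroup.closure {x : PuncturedSurfaceGroup (g₀ + (g₁ + g₂)) r |
        (∃ i : Fin (g₀ + (g₁ + g₂)), (g₀ ≤ (i : ℕ) ∧ (i : ℕ) < g₀ + g₁) ∧ (x = a i ∨ x = b i)) ∨
          (∃ j : Fin r, (s₁ ≤ (j : ℕ) ∧ (j : ℕ) < s₂) ∧ x = c j) ∨ x = εA ∨ x = η}).map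
      (QuotientGroup.mk' K) = θ.range := by
  rw [MonoidHom.range_eq_map, ← PresentedGroup.closure_range_of, MonoidHom.map_closure,
    MonoidHom.map_closure]
  apply le_antisymm
  · refine (Subgroup.closure_le _).mpr ?_
    rintro y ⟨x, hx, rfl⟩
    rcases hx with ⟨i, hi, rfl | rfl⟩ | ⟨j, -, rfl⟩ | rfl | rfl
    · have hi' : (i : ℕ) - g₀ < g₁ := by omega
      have hii : i = Fin.natAdd g₀ (Fin.castAdd g₂ ⟨(i : ℕ) - g₀, hi'⟩) :=
        Fin.ext (by simp only [Fin.val_natAdd, Fin.val_castAdd]; omega)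
      refine Subgroup.subset_closure ⟨a ⟨(i : ℕ) - g₀, hi'⟩, ⟨Sum.inl (⟨(i : ℕ) - g₀, hi'⟩, false), rfl⟩, ?_⟩
      change θ (PresentedGroup.of (Sum.inl (⟨(i : ℕ) - g₀, hi'⟩, false))) = _
      rw [hpin, QuotientGroup.mk'_apply]
      exact congrArg (fun t : Fin (g₀ + (g₁ + g₂)) =>
        (QuotientGroup.mk (PresentedGroup.of (Sum.inl (t, false))) :
          PuncturedSurfaceGroup (g₀ + (g₁ + g₂)) r ⧸ K)) hii.symm
    · have hi' : (i : ℕ) - g₀ < g₁ := by omega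
      have hii : i = Fin.natAdd g₀ (Fin.castAdd g₂ ⟨(i : ℕ) - g₀, hi'⟩) :=
        Fin.ext (by simp only [Fin.val_natAdd, Fin.val_castAdd]; omega)
      refine Subgroup.subset_closure ⟨b ⟨(i : ℕ) - g₀, hi'⟩, ⟨Sum.inl (⟨(i : ℕ) - g₀, hi'⟩, true), rfl⟩, ?_⟩
      change θ (PresentedGroup.of (Sum.inl (⟨(i : ℕ) - g₀, hi'⟩, true))) = _
      rw [hpin, QuotientGroup.mk'_apply]
      exact congrArg (fun t : Fin (g₀ + (g₁ + g₂)) =>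
        (QuotientGroup.mk (PresentedGroup.of (Sum.inl (t, true))) :
          PuncturedSurfaceGroup (g₀ + (g₁ + g₂)) r ⧸ K)) hii.symm
    · rw [QuotientGroup.mk'_apply, (QuotientGroup.eq_one_iff _).mpr (hcK j)]
      exact Subgroup.one_mem _
    · rw [QuotientGroup.mk'_apply, (QuotientGroup.eq_one_iff _).mpr hεAK]
      exact Subgroup.one_mem _
    · rw [QuotientGroup.mk'_apply, (QuotientGroup.eq_one_iff _).mpr hηK]
      exact Subgroup.one_mem _
  · refine (Subgroup.closure_le _).mpr ?_
    rintro y ⟨z, ⟨x, rfl⟩, rfl⟩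
    rcases x with ⟨j, bit⟩ | j
    · refine Subgroup.subset_closure
        ⟨PresentedGroup.of (Sum.inl (Fin.natAdd g₀ (Fin.castAdd g₂ j), bit)), ?_, ?_⟩
      · refine Or.inl ⟨Fin.natAdd g₀ (Fin.castAdd g₂ j),
          ⟨by simp only [Fin.val_natAdd, Fin.val_castAdd]; omega,
            by simp only [Fin.val_natAdd, Fin.val_castAdd]; omega⟩, ?_⟩
        cases bit
        · exact Or.inl rfl
        · exact Or.inr rfl
      · rw [QuotientGroup.mk'_apply, ← hpin j bit]
    · exact Fin.elim0 j

/-- In `Γ/K` (`c_j, η ∈ K`) the generating set of `Π_{v₁}` — handles `g₀ + g₁ ≤ i`, cusps `j < s₁`, the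
node loop `η` — generates the last factor: its image is the range of any hom `Γ_{g₂,0} → Γ/K` pinned on
the last handle letters. [cite: MochizukiCombGC2007, Def 1.1(ii) p.7] -/
theorem map_mk_closure_chainLast_eq_range (hcK : ∀ j, c j ∈ K) {η : PuncturedSurfaceGroup (g₀ + (g₁ + g₂)) r}
    (hηK : η ∈ K) (θ : PuncturedSurfaceGroup g₂ 0 →* _ ⧸ K)
    (hpin : ∀ (k : Fin g₂) (bit : Bool), θ (PresentedGroup.of (Sum.inl (k, bit))) =
      QuotientGroup.mk (PresentedGroup.of (Sum.inl (Fin.natAdd g₀ (Fin.natAdd g₁ k), bit)))) :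
    (Subgroup.closure {x : PuncturedSurfaceGroup (g₀ + (g₁ + g₂)) r |
        (∃ i : Fin (g₀ + (g₁ + g₂)), g₀ + g₁ ≤ (i : ℕ) ∧ (x = a i ∨ x = b i)) ∨
          (∃ j : Fin r, (j : ℕ) < s₁ ∧ x = c j) ∨ x = η}).map (QuotientGroup.mk' K) = θ.range := by
  rw [MonoidHom.range_eq_map, ← PresentedGroup.closure_range_of, MonoidHom.map_closure,
    MonoidHom.map_closure]
  apply le_antisymm
  · refine (Subgroup.closure_le _).mpr ?_
    rintro y ⟨x, hx, rfl⟩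
    rcases hx with ⟨i, hi, rfl | rfl⟩ | ⟨j, -, rfl⟩ | rfl
    · have hi' : (i : ℕ) - (g₀ + g₁) < g₂ := by omega
      have hii : i = Fin.natAdd g₀ (Fin.natAdd g₁ ⟨(i : ℕ) - (g₀ + g₁), hi'⟩) :=
        Fin.ext (by simp only [Fin.val_natAdd]; omega)
      refine Subgroup.subset_closure
        ⟨a ⟨(i : ℕ) - (g₀ + g₁), hi'⟩, ⟨Sum.inl (⟨(i : ℕ) - (g₀ + g₁), hi'⟩, false), rfl⟩, ?_⟩
      change θ (PresentedGroup.of (Sum.inl (⟨(i : ℕ) - (g₀ + g₁), hi'⟩, false))) = _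
      rw [hpin, QuotientGroup.mk'_apply]
      exact congrArg (fun t : Fin (g₀ + (g₁ + g₂)) =>
        (QuotientGroup.mk (PresentedGroup.of (Sum.inl (t, false))) :
          PuncturedSurfaceGroup (g₀ + (g₁ + g₂)) r ⧸ K)) hii.symm
    · have hi' : (i : ℕ) - (g₀ + g₁) < g₂ := by omega
      have hii : i = Fin.natAdd g₀ (Fin.natAdd g₁ ⟨(i : ℕ) - (g₀ + g₁), hi'⟩) :=
        Fin.ext (by simp only [Fin.val_natAdd]; omega)
      refine Subgroup.subset_closure
        ⟨b ⟨(i : ℕ) - (g₀ + g₁), hi'⟩, ⟨Sum.inl (⟨(i : ℕ) - (g₀ + g₁), hi'⟩, true), rfl⟩, ?_⟩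
      change θ (PresentedGroup.of (Sum.inl (⟨(i : ℕ) - (g₀ + g₁), hi'⟩, true))) = _
      rw [hpin, QuotientGroup.mk'_apply]
      exact congrArg (fun t : Fin (g₀ + (g₁ + g₂)) =>
        (QuotientGroup.mk (PresentedGroup.of (Sum.inl (t, true))) :
          PuncturedSurfaceGroup (g₀ + (g₁ + g₂)) r ⧸ K)) hii.symm
    · rw [QuotientGroup.mk'_apply, (QuotientGroup.eq_one_iff _).mpr (hcK j)]
      exact Subgroup.one_mem _
    · rw [QuotientGroup.mk'_apply, (QuotientGroup.eq_one_iff _).mpr hηK]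
      exact Subgroup.one_mem _
  · refine (Subgroup.closure_le _).mpr ?_
    rintro y ⟨z, ⟨x, rfl⟩, rfl⟩
    rcases x with ⟨k, bit⟩ | j
    · refine Subgroup.subset_closure
        ⟨PresentedGroup.of (Sum.inl (Fin.natAdd g₀ (Fin.natAdd g₁ k), bit)), ?_, ?_⟩
      · refine Or.inl ⟨Fin.natAdd g₀ (Fin.natAdd g₁ k), by simp only [Fin.val_natAdd]; omega, ?_⟩
        cases bit
        · exact Or.inl rfl
        · exact Or.inr rfl
      · rw [QuotientGroup.mk'_apply, ← hpin k bit]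
    · exact Fin.elim0 j

end Vertex

end PuncturedSurfaceGroup

end Literature.GroupTheory.CombinatorialGroupTheory
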